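import Summits.BirchSwinnertonDyer.BirchSwinnertonDyer.Theorems.AdditiveBranchIMCGordTwoTwistedChainR0Kronecker
import Summits.BirchSwinnertonDyer.BirchSwinnertonDyer.Theorems.AdditiveBranchIMCGordTwoTwistedDyadicClass
import HarnessLib

/-!
# Door D («`ℓ₀ = 2`») groundwork: `p ∤ ∏ c(E) ⟹ p ∤ ∏ c(E^{(d_K)})` on the DYADIC twisted road (crux 19357 `three_field_road`, LeadReport27 §5 item 6;
# LEAD cruxlead-19357 g18, `--supports` 19357, helper only)

Theorems only. For `E` (globally minimal `W`), `p ≥ 5`, a dyadic twisted Wan prime (`W₁ = E^{(t)}` multiplicative at `2`, `t ∈ {−1, 2, −2}`) and a road field `K`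
with `d_K = 4·t·n` in the dyadic genus class (p814401: a globally minimal `Wd ≅ E^{(d_K)}` is multiplicative NON-split at `2`) whose ODD bad primes are split:
`p ∤ ∏ c(E) ⟹ p ∤ ∏ c(Wd)`, place by place exactly as on the loose road (p817204): at a split bad prime `d_K` is a local square (same local Tamagawa number),
at `2` non-splitness gives `c₂ ≤ 4 < p`, elsewhere `Wd` is not split multiplicative. No Skinner–Urban clause at `2` is needed.

* `not_dvd_tamagawaProduct_twist_of_dyadicClass`.

References: [JetchevSkinnerWan2017] §7.3.1; [SilvermanAEC2009] VII.6.1, X.5.4. BSD is proved for no curve.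
-/

set_option autoImplicit false
set_option linter.dupNamespace false

noncomputable section

open scoped Classical

open WeierstrassCurve IsDedekindDomain IsDedekindDomain.HeightOneSpectrum NumberField Rat.HeightOneSpectrum
  Literature.NumberTheory.EllipticCurves Literature.NumberTheory.EllipticCurves.ModularForms
  Literature.NumberTheory.EllipticCurves.Rank1Residual Literature.NumberTheory.QuadraticFields
  Summit.BirchSwinnertonDyer.Rank1Residual Summit.BirchSwinnertonDyer.Rank1Residual.Additive
  Summit.BirchSwinnertonDyer.BirchSwinnertonDyer.Theorems

namespace Summit.BirchSwinnertonDyer.BirchSwinnertonDyer.Theorems.TwistedWanRoad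

open ThreeFieldRoadSupply WanAnyRoad Literature.NumberTheory.EllipticCurves.Rank1Residual.Typed
  Literature.NumberTheory.EllipticCurves.CaiShuTian2014 Literature.NumberTheory.EllipticCurves.LiuZhangZhang2018
open Literature.NumberTheory.EllipticCurves.Castella2018.TamagawaQuadratic (one_lt_valuation_j kodairaNeron_localTamagawaNumber
  localTamagawaNumber_eq_of_twist_of_isSquare isSquare_padic_discr_of_splitsIn)


/-- **`p ∤ ∏ c(E) ⟹ p ∤ ∏ c(E^{(d_K)})` on the dyadic twisted road** (module docstring). [cite: JetchevSkinnerWan2017, §7.3.1 (eq:tamK)]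
[cite: SilvermanAEC2009, Thm VII.6.1 and X.5 Cor. 5.4] -/
theorem not_dvd_tamagawaProduct_twist_of_dyadicClass (W : WeierstrassCurve ℚ) [W.IsElliptic] [W.IsGloballyMinimal] (p : ℕ) [hp : Fact p.Prime]
    (hp5 : 5 ≤ p) {t : ℤ} (ht : t = -1 ∨ t = 2 ∨ t = -2) (hmult : (W.quadraticTwist (t : ℚ)).HasMultiplicativeReductionAtPrime 2)
    (K : Type) [Field K] [NumberField K] (hKiq : IsImaginaryQuadratic K) {n : ℤ} (hn : NumberField.discr K = 4 * t * n)
    (hclass : n % 8 = if (W.quadraticTwist (t : ℚ)).HasSplitMultiplicativeReductionAtPrime 2 then 5 else 1)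
    (hsplit : ∀ r : ℕ, r.Prime → r ∣ W.conductorNorm ℤ → r ≠ 2 → ((Ideal.span {(r : ℤ)}).primesOver (𝓞 K)).ncard = 2)
    (Wd : WeierstrassCurve ℚ) [Wd.IsElliptic] [Wd.IsGloballyMinimal] (Cd : VariableChange ℚ)
    (hWd : Cd • W.quadraticTwist (NumberField.discr K : ℚ) = Wd) (htam : ¬ p ∣ W.tamagawaProduct) :
    ¬ p ∣ Wd.tamagawaProduct := by
  haveI : Fact (Nat.Prime 2) := ⟨Nat.prime_two⟩
  have hD0 : (NumberField.discr K : ℚ) ≠ 0 := by exact_mod_cast NumberField.discr_ne_zero K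
  obtain ⟨-, hWdns⟩ := quadraticTwist_discr_nonsplit_at_two_of_dyadicClass W ht hmult K hn hclass Wd ⟨Cd, hWd⟩
  refine not_dvd_tamagawaProduct_of_forall Wd p fun v ↦ ?_
  set ℓ : ℕ := (primesEquiv v : ℕ) with hℓdef
  haveI hℓF : Fact ℓ.Prime := ⟨(primesEquiv v).2⟩
  by_cases hsv : Wd.HasSplitMultiplicativeReductionAt v
  · -- split multiplicative: `ℓ ∣ N_E`, `ℓ ≠ q`, so `ℓ` splits in `K`, `d_K` is an `ℓ`-adic square, and `c_ℓ(Wd) = c_ℓ(E)`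
    have hmv := hsv.hasMultiplicativeReductionAt
    have hℓq : ℓ ≠ 2 := by
      intro hℓq
      have hsp := (Wd.hasSplitMultiplicativeReductionAtPrime_iff_hasSplitMultiplicativeReductionAt v).mpr hsv
      have key : ∀ (n : ℕ) (i₁ : Fact n.Prime) (i₂ : Fact (Nat.Prime 2)), n = 2 →
          @HasSplitMultiplicativeReductionAtPrime Wd n i₁ → @HasSplitMultiplicativeReductionAtPrime Wd 2 i₂ := by
        rintro n i₁ i₂ rfl h; exact h
      exact hWdns (key _ _ _ hℓq hsp)
    -- `E` is bad at `ℓ`: otherwise `j(Wd) = j(E)` is `ℓ`-integral, contradicting multiplicative reduction of `Wd`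
    have hjd : Wd.j = W.j := AdditivePotMult.j_of_model_twist hD0 ⟨Cd, hWd⟩
    have hℓN : ℓ ∣ W.conductorNorm ℤ := by
      by_contra hℓN
      have hgood : W.HasGoodReductionAtPrime ℓ :=
        not_not.mp (mt (W.dvd_conductorNorm_iff_not_hasGoodReductionAtPrime ℓ).mpr hℓN)
      have hle : v.valuation ℚ Wd.j ≤ 1 := by
        rw [hjd]
        exact Additive.valuation_j_le_one_of_hasGoodReductionAt W v
          ((hasGoodReductionAtPrime_iff_hasGoodReductionAt_ringOfIntegers v W).mp hgood)
      exact (not_lt.mpr hle) (one_lt_valuation_j v Wd hmv)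
    have hsq : IsSquare ((NumberField.discr K : ℚ) : ℚ_[ℓ]) :=
      isSquare_padic_discr_of_splitsIn hKiq.1 (hsplit ℓ hℓF.out hℓN hℓq)
    rw [localTamagawaNumber_eq_of_twist_of_isSquare W v (ℓ := ℓ) rfl hD0 hsq Wd hWd]
    intro hdvd
    apply htam
    set cW : HeightOneSpectrum (𝓞 ℚ) → ℕ := fun v =>
      (W.baseChange (v.adicCompletion ℚ)).localTamagawaNumber (v.adicCompletionIntegers ℚ) with hcW
    have hfin : (Function.mulSupport cW).Finite := W.mulSupport_localTamagawaNumber_finite_holds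
    rw [show W.tamagawaProduct = ∏ᶠ v, cW v from rfl,
      finprod_eq_prod_of_mulSupport_subset cW (s := hfin.toFinset) (by simp)]
    by_cases hv1 : cW v = 1
    · exfalso
      have : p ∣ 1 := by rw [← hv1]; exact hdvd
      exact hp.out.ne_one (Nat.dvd_one.mp this)
    · exact hdvd.trans (Finset.dvd_prod_of_mem cW (hfin.mem_toFinset.mpr hv1))
  · -- not split multiplicative: `c_v(Wd) ≤ 4 < p`
    obtain ⟨h1, -, h4⟩ := kodairaNeron_localTamagawaNumber Wd v
    have hc4 := h4 hsv
    intro hdvd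
    have := Nat.le_of_dvd (by omega) hdvd
    omega


end Summit.BirchSwinnertonDyer.BirchSwinnertonDyer.Theorems.TwistedWanRoad

end
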